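import Summits.Langlands.Langlands.Theses.MonomialConverse
import Literature.NumberTheory.Automorphic.PairLFunctionBaseChange

/-!
# Birth skeleton (BC3) — crux `CPSConverseGL1` (stmt-Langlands-18579), route `MonomialConverse`

Route `route-Langlands-MonomialConverse` (Langlands/Langlands); crux decl
`Summit.Langlands.Langlands.Theses.MonomialConverse.CPSConverseGL1` (rank 2, THE CONDITION OF THE
BRIDGE): Cogdell–Piatetski-Shapiro's `GL₁`-twist converse conjecture (Publ. IHÉS 79 (1994) p. 166) in
the ANALYTIC form over the carrier `TwistedStandardLData N K`:

  `∀ N K D, 1 ≤ N → D.AllTwistsNice → ∃ hcpt (P : AutomorphicRepData (gl N K hcpt)), ∀ᶠ v, P.HasSatakeParamAt v (D.α v)`.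

## The line: Cogdell–Piatetski-Shapiro two-step, corrected for the isobaric obstruction

This is the route header's TWO-LAYER PLAN (`CPSConverseGL1 ⇐ TwistPropagation → CPSIITheorem`), with
the one correction the plan needs to be TRUE in the expected world.  The only converse theorems for
`GL_N`, `N ≥ 4`, in print twist by cuspidal representations of `GL_m`, `m ≤ N - 2` (Cogdell–
Piatetski-Shapiro, *Converse theorems for GL_n II*, J. reine angew. Math. 507 (1999), Thm. 2 = Cogdell
2004, Thm. 5.2, p. 205 of the held `book:editornd-introduction-langlands-program`), so the conjecture
for `N ≥ 4` is EQUIVALENT (given Thm. 5.2 and the Rankin–Selberg theory of isobaric representations) to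
an analytic propagation statement: niceness of all `GL₁`-twists of `D` forces niceness of its twists by
cuspidal `τ` on `GL_m`, `2 ≤ m ≤ N - 2`.  The NAIVE propagation ("… for ALL such `τ`") is FALSE at
`N = 4`: an isobaric `Π = σ₁ ⊞ σ₂` (`σᵢ` cuspidal on `GL₂`) has all `GL₁`-twists entire but
`L(s, Π × σ₁^∨)` has a pole.  The correction is Cogdell's "Observation" (op. cit. p. 205, the form used
in every functorial lifting): twist the class `T(S; N-2)` (cuspidals UNRAMIFIED at a finite set `S`) by
a fixed character `η`; choosing `S = {v₀}` with `Π` unramified at `v₀` and `η` ramified at `v₀`, no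
`τ ⊗ η` (`τ` unramified at `v₀`) can be contragredient to an isobaric constituent of `Π` up to `|det|ˢ`,
so all `L(s, Π × (τ ⊗ η))` are entire.  Hence three stubs:

* `stub_rankLeTwo` (KNOWN SECTOR, theorem-level in print for genuine `Π`): the crux for `N ≤ 2` —
  `N = 1` is Hecke–Tate (provable now in the tree: `D.α v = {ω_Π(ϖ_v)}` by `card_α`/`prod_α`, realised
  by `exists_automorphicRepData_hasSatakeParamAt_valueAtUniformizer`, refuter evidence `RankOne.lean`),
  `N = 2` is Jacquet–Langlands' converse theorem (LNM 114 Thm. 11.3; Cogdell 2004 Thm. 5.1 with `n = 2`,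
  "valid for `n = 2` as well", p. 205).  Analytic-form caveat as for the crux (free data at `S`, `∞`, `ε`).
* `stub_twistPropagation` (OPEN HEART, `N ≥ 4`; no instance in print; equivalent in strength to the
  conjecture given the other two stubs): `D.AllTwistsNice → ∃ S' η, ∀ m ∈ [2, N-2], ∀ τ` cuspidal on
  `GL_m` unramified at `S'` with Satake family `β` a.e., the Rankin–Selberg twist `D ⊠ (τ ⊗ η)` — as a
  degree-`N·m` datum `E` over the SAME carrier whose Satake family off `E.S` is the tensor family
  `satakeTensor (D.α v) (η(ϖ_v) • β v)` — has nice standard `L`-function (`NiceTwistedStandardL E 1`: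
  entire, bounded in vertical strips, functional equation against the dual tensor family).  The
  `GL₁`-layer of `T(S'; N-2) ⊗ η` is not part of this stub: it is literally `D.IsNice (χ * η)`, discharged
  in the assembly from `AllTwistsNice`.
* `stub_cpsII` (THEOREM-LEVEL IN PRINT for genuine `Π`, analytic form here): Cogdell 2004 Thm. 5.2 +
  Observation (= CPS 1999 Thm. 2 with `S`, `η`), `N ≥ 3`: if `D.IsNice (χ * η)` for every Hecke
  character `χ` unramified at `S'` and every `D ⊠ (τ ⊗ η)`, `τ ∈ T(S'; m)`, `2 ≤ m ≤ N - 2`, is nice in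
  the above sense, then `D` is quasi-automorphic a.e. (print: `Π'` automorphic with `Π'_v ≅ Π_v` for
  `v ∉ S'`; we only keep the a.e. Satake shadow, exactly the crux's conclusion).  At `N = 3` the
  `GL_m`-layer is empty and the stub is JPSS's `GL(3)` converse theorem with `GL₁`-twists.

Assembly `CPSConverseGL1_of_stubs : <stub₁-sig> → <stub₂-sig> → <stub₃-sig> → <body of CPSConverseGL1>`
is a REAL proof (case split `N ≤ 2` / `N = 3` with `S' = ∅`, `η = 1`, empty `GL_m`-layer / `N ≥ 4`
through the propagation witnesses), and `CPSConverseGL1_of : CPSConverseGL1 := CPSConverseGL1_of_stubs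
stub_rankLeTwo stub_twistPropagation stub_cpsII` concludes the crux BY NAME from the stubs BY NAME (the
kernel checks that the registered stub statements are literally the binders).  `sorry` occurs ONLY in
the three `stub_*`.

Disproof used: none exists for this crux (`ledger crux ls stmt-Langlands-18579`: no workfiles,
2026-08-17).  Negatives index (Langlands): SplitPrimeInduction deinduction, OrdinaryPrimeTransport n = 0,
K3 anchor — unrelated; no stub is an instance of a refuted statement.  Refuter evidence honoured: the
`N = 1` degenerate instance is a theorem with `AllTwistsNice` unused (inside `stub_rankLeTwo`, not
claimed as content); the junk audit of the carrier (no cheap fake-nice datum) applies verbatim to the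
tensor data `E`.
-/

-- `Summit.<Summit>.<Problem>`: for the single-conjunct summit `Langlands` the duplicate is mandated.
set_option linter.dupNamespace false

namespace Summit.Langlands.Langlands.Cruxes.CPSConverseGL1.Birth

open scoped Classical
open Filter IsDedekindDomain NumberField
open Literature.NumberTheory.Automorphic Literature.NumberTheory.GaloisRepresentations
open Summit.Langlands.Langlands.Theses.MonomialConverse (CPSConverseGL1)

/-! ## The registered stubs -/

/-- **Stub 1 (KNOWN SECTOR `N ≤ 2`; theorem-level in print for genuine `Π`).** The `GL₁`-twist
converse statement for `GL₁` and `GL₂` over every number field, analytic form over the carrier: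
`N = 1` — off `S` the datum IS the Satake family `{ω_Π(ϖ_v)}` of its central Hecke character
(`card_α`, `prod_α`), realised on `GL₁` by the tree's rank-one dictionary (Hecke 1920 / Tate; provable
now, cf. refuter evidence `RankOne.lean`); `N = 2` — Jacquet–Langlands' converse theorem (all
`GL₁`-twists nice ⇒ automorphic), Cogdell 2004 Thm. 5.1 at `n = 2`, `S = ∅`.  Why it might fail: only
the ANALYTIC form (free local data at `S`, `∞` and free `ε`) is stronger than JL Thm. 11.3, which is
stated for a genuine `π = ⊗ π_v`; a fake-`Γ` datum would have to survive all twisted functional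
equations (none known; cf. Booker–Krishnamurthy 2011 Thm. 1.1 for the robustness of the `GL₂` case).
Sources: JacquetLanglands1970 Thm. 11.3; CogdellAnalyticTheory2004 Thm. 5.1 (p. 205);
TateThesis1967; BookerKrishnamurthy2011 Thm. 1.1. -/
theorem stub_rankLeTwo :
    ∀ (N : ℕ) (K : Type) [Field K] [NumberField K] (D : TwistedStandardLData N K),
      1 ≤ N → N ≤ 2 → D.AllTwistsNice →
        ∃ (hcpt : isCompact_glFiniteIntegralLevel N K)
          (P : AutomorphicRepData (AutomorphyDatum.gl N K hcpt)),
          ∀ᶠ v : HeightOneSpectrum (𝓞 K) in cofinite, P.HasSatakeParamAt v (D.α v) := by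
  sorry

/-- **Stub 2 (OPEN HEART, `N ≥ 4`): twist propagation in Cogdell's `T(S'; N-2) ⊗ η` class.**  If all
`GL₁`-twists of the degree-`N` datum `D` are nice, then for SOME finite set `S'` of finite places and
SOME Hecke character `η` (intended: `S' = {v₀}` with `v₀ ∉ D.S`, `η` ramified at `v₀` — this is what
kills the isobaric poles `L(s, (σ₁ ⊞ σ₂) × σ₁^∨)`), every Rankin–Selberg twist `D ⊠ (τ ⊗ η)` by a
cuspidal `τ` on `GL_m`, `2 ≤ m ≤ N - 2`, unramified at `S'`, with Satake family `β` almost everywhere,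
is NICE as a degree-`N·m` datum `E` over the same carrier: off `E.S` its Satake family is the tensor
family `{aᵢ(v) · η(ϖ_v) bⱼ(v)}` and its standard completed `L`-function (trivial twist) is entire,
bounded in vertical strips and satisfies the functional equation against the dual tensor family
(`NiceTwistedStandardL E 1`).  TRUE in the expected world (conjecture ⇒ `D` quasi-automorphic,
isobaric `σ₁ ⊞ ⋯ ⊞ σ_r`; `σᵢ` unramified at `v₀` is never `(τ ⊗ η)^∨ ⊗ |det|ˢ`, so every
`L(s, σᵢ × (τ ⊗ η))` is entire by Jacquet–Shalika, bounded in strips and with functional equation by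
the Rankin–Selberg theory; `E` = product data), and with Stub 3 it gives the crux back: it is the
conjecture's analytic content, isolated from automorphy.  Why it might fail: no analytic mechanism
propagating niceness from `GL₁`- to `GL_m`-twists is known for any `N ≥ 4` (CPS 1994 p. 166; the
twisting rank has only come down to `N - 2`, CPS 1999, and `⌊N/2⌋` locally, Jacquet–Liu); a junk
datum `D` nice for all Hecke twists but with non-automorphic tensor families would refute it together
with the conjecture.  Sources: CogdellPiatetskishapiro1994 §2 (p. 166); CogdellPiatetskishapiro1999
Thm. 2; CogdellAnalyticTheory2004 Thm. 5.2 + Observation (p. 205); JacquetShalikaAJM1981II;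
arXiv:1604.02033. -/
theorem stub_twistPropagation :
    ∀ (N : ℕ) (K : Type) [Field K] [NumberField K] (D : TwistedStandardLData N K),
      4 ≤ N → D.AllTwistsNice →
        ∃ (S' : Finset (HeightOneSpectrum (𝓞 K))) (η : HeckeCharacter K),
          ∀ (m : ℕ), 2 ≤ m → m + 2 ≤ N →
            ∀ (hc : isCompact_glFiniteIntegralLevel m K) (τ : CuspidalAutomorphicRepData m K hc)
              (β : SatakeFamily K),
              (∀ v ∈ S', τ.1.IsUnramifiedAt v) →
              (∀ᶠ v : HeightOneSpectrum (𝓞 K) in cofinite, τ.1.HasSatakeParamAt v (β v)) →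
                ∃ E : TwistedStandardLData (N * m) K,
                  (∀ v ∉ E.S, E.α v =
                    satakeTensor (D.α v) ((β v).map fun b => η.valueAtUniformizer v * b)) ∧
                  NiceTwistedStandardL E 1 := by
  sorry

/-- **Stub 3 (THEOREM-LEVEL IN PRINT for genuine `Π`; analytic form): Cogdell–Piatetski-Shapiro II
with a finite set `S'` and a character twist `η`.**  For `N ≥ 3`, any finite set `S'` of finite places
and any Hecke character `η`: if `L(Π ⊗ χη)` is nice for every Hecke character `χ` unramified at `S'`
(the `GL₁`-layer of `T(S'; N-2) ⊗ η`, literally `D.IsNice (χ * η)`) and every Rankin–Selberg twist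
`D ⊠ (τ ⊗ η)`, `τ` cuspidal on `GL_m`, `2 ≤ m ≤ N - 2`, unramified at `S'`, is nice as a degree-`N·m`
datum over the carrier (as in Stub 2), then `D` is quasi-automorphic: some automorphic `P` on
`GL_N(𝔸_K)` has Satake parameter `D.α v` at almost every `v`.  Print (Cogdell 2004 Thm. 5.2 =
CPS 1999 Thm. 2 with `S`; Observation p. 205 for `⊗ η`, via `L(Π × (τ ⊗ η)) = L((Π ⊗ η) × τ)`):
conclusion `Π'_v ≅ Π_v` for all `v ∉ S'` — we keep only its a.e. Satake shadow; at `N = 3` the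
`GL_m`-layer is empty and this is the JPSS `GL(3)` converse theorem with `GL₁`-twists.  Why it might
fail: as for the crux, the ANALYTIC form (free local data of `D` and of the tensor data `E` at bad
places, at `∞`, free `ε`) is stronger than the printed theorem, whose proof runs the local functional
equations of the ACTUAL `Π_v × τ_v`; a fake datum surviving all functional equations would break it
(kill criterion (ii) of the route: restate over genuine `Π`, definition request D1 `GenuineTwistedPi`).
Sources: CogdellPiatetskishapiro1999 Thm. 2; CogdellAnalyticTheory2004 Thm. 5.2 and Observation
(p. 205); CogdellPiatetskishapiro1994 §2; JacquetPiatetskishapiroShalika1979II §13. -/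
theorem stub_cpsII :
    ∀ (N : ℕ) (K : Type) [Field K] [NumberField K] (D : TwistedStandardLData N K),
      3 ≤ N → ∀ (S' : Finset (HeightOneSpectrum (𝓞 K))) (η : HeckeCharacter K),
        (∀ χ : HeckeCharacter K, (∀ v ∈ S', χ.IsUnramifiedAt v) →
          NiceTwistedStandardL D (χ * η)) →
        (∀ (m : ℕ), 2 ≤ m → m + 2 ≤ N →
            ∀ (hc : isCompact_glFiniteIntegralLevel m K) (τ : CuspidalAutomorphicRepData m K hc)
              (β : SatakeFamily K),
              (∀ v ∈ S', τ.1.IsUnramifiedAt v) →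
              (∀ᶠ v : HeightOneSpectrum (𝓞 K) in cofinite, τ.1.HasSatakeParamAt v (β v)) →
                ∃ E : TwistedStandardLData (N * m) K,
                  (∀ v ∉ E.S, E.α v =
                    satakeTensor (D.α v) ((β v).map fun b => η.valueAtUniformizer v * b)) ∧
                  NiceTwistedStandardL E 1) →
        ∃ (hcpt : isCompact_glFiniteIntegralLevel N K)
          (P : AutomorphicRepData (AutomorphyDatum.gl N K hcpt)),
          ∀ᶠ v : HeightOneSpectrum (𝓞 K) in cofinite, P.HasSatakeParamAt v (D.α v) := by
  sorry

/-! ## The assembly (real proof, no `sorry`) -/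

/-- **Assembly, arrow form (real proof, no `sorry`).** The three stub statements imply the BODY of
the crux `CPSConverseGL1` (stated unfolded here so that exactly one theorem of this file, the by-name
registration `CPSConverseGL1_of` below, concludes the crux constant): `N ≤ 2` is Stub 1; `N = 3` is
Stub 3 with `S' = ∅`, `η = 1` and the empty `GL_m`-layer (`2 ≤ m`, `m + 2 ≤ 3` is absurd), its
`GL₁`-layer fed by `AllTwistsNice`; `N ≥ 4` is Stub 3 at the witnesses `S'`, `η` of Stub 2, the
`GL₁`-layer again fed by `AllTwistsNice` (`D.IsNice (χ * η)` is an instance). [folklore] -/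
theorem CPSConverseGL1_of_stubs :
    (∀ (N : ℕ) (K : Type) [Field K] [NumberField K] (D : TwistedStandardLData N K),
      1 ≤ N → N ≤ 2 → D.AllTwistsNice →
        ∃ (hcpt : isCompact_glFiniteIntegralLevel N K)
          (P : AutomorphicRepData (AutomorphyDatum.gl N K hcpt)),
          ∀ᶠ v : HeightOneSpectrum (𝓞 K) in cofinite, P.HasSatakeParamAt v (D.α v)) →
    (∀ (N : ℕ) (K : Type) [Field K] [NumberField K] (D : TwistedStandardLData N K),
      4 ≤ N → D.AllTwistsNice →
        ∃ (S' : Finset (HeightOneSpectrum (𝓞 K))) (η : HeckeCharacter K),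
          ∀ (m : ℕ), 2 ≤ m → m + 2 ≤ N →
            ∀ (hc : isCompact_glFiniteIntegralLevel m K) (τ : CuspidalAutomorphicRepData m K hc)
              (β : SatakeFamily K),
              (∀ v ∈ S', τ.1.IsUnramifiedAt v) →
              (∀ᶠ v : HeightOneSpectrum (𝓞 K) in cofinite, τ.1.HasSatakeParamAt v (β v)) →
                ∃ E : TwistedStandardLData (N * m) K,
                  (∀ v ∉ E.S, E.α v =
                    satakeTensor (D.α v) ((β v).map fun b => η.valueAtUniformizer v * b)) ∧
                  NiceTwistedStandardL E 1) →
    (∀ (N : ℕ) (K : Type) [Field K] [NumberField K] (D : TwistedStandardLData N K),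
      3 ≤ N → ∀ (S' : Finset (HeightOneSpectrum (𝓞 K))) (η : HeckeCharacter K),
        (∀ χ : HeckeCharacter K, (∀ v ∈ S', χ.IsUnramifiedAt v) →
          NiceTwistedStandardL D (χ * η)) →
        (∀ (m : ℕ), 2 ≤ m → m + 2 ≤ N →
            ∀ (hc : isCompact_glFiniteIntegralLevel m K) (τ : CuspidalAutomorphicRepData m K hc)
              (β : SatakeFamily K),
              (∀ v ∈ S', τ.1.IsUnramifiedAt v) →
              (∀ᶠ v : HeightOneSpectrum (𝓞 K) in cofinite, τ.1.HasSatakeParamAt v (β v)) →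
                ∃ E : TwistedStandardLData (N * m) K,
                  (∀ v ∉ E.S, E.α v =
                    satakeTensor (D.α v) ((β v).map fun b => η.valueAtUniformizer v * b)) ∧
                  NiceTwistedStandardL E 1) →
        ∃ (hcpt : isCompact_glFiniteIntegralLevel N K)
          (P : AutomorphicRepData (AutomorphyDatum.gl N K hcpt)),
          ∀ᶠ v : HeightOneSpectrum (𝓞 K) in cofinite, P.HasSatakeParamAt v (D.α v)) →
    ∀ (N : ℕ) (K : Type) [Field K] [NumberField K] (D : TwistedStandardLData N K),
      1 ≤ N → D.AllTwistsNice →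
        ∃ (hcpt : isCompact_glFiniteIntegralLevel N K)
          (P : AutomorphicRepData (AutomorphyDatum.gl N K hcpt)),
          ∀ᶠ v : HeightOneSpectrum (𝓞 K) in cofinite, P.HasSatakeParamAt v (D.α v) := by
  intro h₁ h₂ h₃ N K _ _ D hN hnice
  by_cases hle : N ≤ 2
  · exact h₁ N K D hN hle hnice
  · have h3N : 3 ≤ N := by omega
    by_cases h4 : 4 ≤ N
    · obtain ⟨S', η, hb⟩ := h₂ N K D h4 hnice
      exact h₃ N K D h3N S' η (fun χ _ => hnice (χ * η)) hb
    · exact h₃ N K D h3N ∅ 1 (fun χ _ => hnice (χ * 1))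
        (fun m hm hmN => absurd hmN (by omega))

/-- **Assembly, by-name registration.** The crux `CPSConverseGL1` BY NAME from the three registered
stubs BY NAME (the shape `ledger skeleton check` records: the kernel checks that the `stub_*`
statements are literally the binders of `CPSConverseGL1_of_stubs` and that its conclusion is the
crux's body; this declaration inherits the stubs' `sorry`s through them and is NOT a proof of the
crux — `sorry` itself occurs only inside the three `stub_*`). [folklore] -/
theorem CPSConverseGL1_of : CPSConverseGL1 :=
  CPSConverseGL1_of_stubs stub_rankLeTwo stub_twistPropagation stub_cpsII

end Summit.Langlands.Langlands.Cruxes.CPSConverseGL1.Birth
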